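import Literature.RingTheory.Smooth.AugmentationIdealCotangentBaseChange
import Mathlib.RingTheory.Localization.BaseChange
import Mathlib.RingTheory.Localization.Free
import Mathlib.RingTheory.Localization.FractionRing
import HarnessLib

/-!
# The conormal module of an augmentation ideal over a localised base: generic freeness
# (EGA IV₃ 8.9.4 / 8.5.5; Görtz–Wedhorn I Remark 6.12; Stacks 00RU)

Topic `Literature/RingTheory/Smooth`, namespace `Literature.RingTheory.Smooth`.  SEQUEL of
`AugmentationIdealCotangentBaseChange` (A-p03, p602431: for an augmented `R`-algebra `(S, ε)` with `I = ker ε` and ANY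
`R`-algebra `T`, `tensorCotangentEquivOfAugmentation ε T : T ⊗_R I/I² ≃ₗ[T] I_T/I_T²`, `ker ε_T = I_T`, naturality, charpoly).
THEOREMS + two definitions that are linear isomorphisms; everything from Mathlib and p602431; no named fact, no instance,
no `sorry` (net debt 0).  Cell `hodgecm-mathlib` (D-0151), row II-2β (`shimura1998_prop26_definedOverQbar` `_holds`),
A-p14's cut 04:48:43Z: the `[Module.Free] [Module.Finite]` hypotheses of the cotangent-charpoly comparison
(`Motives/AbelianVarietyCotangentOfFibre`, `charpoly_mapCotangent_baseChange`) hold after inverting ONE nonzero element of a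
domain base.  HC_CM is proved only modulo the 7 printed citations until rung 0 closes.

THE PRINT.  [EGAIV3] (8.9.4)/(8.5.5): a finitely presented module over an integral base is free over a dense open `D(r)`
(«generic freeness» in its trivial form: `M ⊗ Frac R` is free over the field `Frac R = R_{(0)}` and freeness of a finitely
presented module at a localisation descends to some `R[1/r]`, Mathlib `Module.FinitePresentation.exists_free_localizedModule_powers`);
[GortzWedhorn2020] Remark 6.12 (2)–(3) / [StacksProject, Tag 00RU]: the conormal module of a section commutes with base change,
so over `R[1/r]` the conormal module of the base-changed augmentation IS the localised module, hence free and finite.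

WHAT IS PROVED (`ε : S →ₐ[R] R`, `I = augIdeal ε`, `T` an `R`-algebra, `r : R`, `R_r = Localization.Away r`).
* §1 `cotangentEquivOfEq` (cotangent modules of EQUAL ideals) and the bridge
  `cotangentAugIdealBaseChangeEquiv : (augIdeal (baseChangeAugmentation ε T)).Cotangent ≃ₗ[T] (augIdealBaseChange ε T).Cotangent`
  (p602431 `ker_baseChangeAugmentation`), for consumers who spell the ideal of the base change as `ker ε_T`.
* §2 `smul_cotangent_eq_zero_of_mem` (`I` kills `I/I²`), `smul_cotangent_augIdeal_eq` (`s·x = ε(s)·x` on `I/I²`),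
  **`finite_cotangent_augIdeal_of_finite`** (`I/I²` finite over `S` ⇒ finite over `R`; e.g. `S` noetherian,
  `finite_cotangent_augIdeal`).
* §3 **`cotangentAugIdealBaseChangeAwayEquiv ε r : (augIdealBaseChange ε R_r).Cotangent ≃ₗ[R_r] LocalizedModule.Away r (I/I²)`**
  (p602431 ∘ Mathlib `LocalizedModule.equivTensorProduct`), with the `Module.Free` / `Module.Finite` transfers.
* §4 **`exists_ne_zero_free_cotangent_augIdealBaseChange`**: `R` a noetherian DOMAIN, `I/I²` finite over `S` ⇒
  `∃ r ≠ 0`, `(augIdealBaseChange ε R_r).Cotangent` is FREE and FINITE over `R_r` — the form the II-2β junction consumes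
  (then `charpoly_mapCotangent_baseChange ε R_r` is available at the localised stage, and at every further base change of it).

## References
* [EGAIV3] A. Grothendieck, J. Dieudonné, *EGA IV₃*, Publ. Math. IHÉS 28 (1966), (8.5.5), (8.9.4).
* [GortzWedhorn2020] U. Görtz, T. Wedhorn, *Algebraic Geometry I*, 2nd ed. (2020), Remark 6.12 (2)–(3), Prop. 7.27.
* [StacksProject] The Stacks project, Tag 00RU, Tag 051Q (generic freeness).
-/

noncomputable section

open TensorProduct

namespace Literature.RingTheory.Smooth

universe u v w

variable {R : Type u} {S : Type v} [CommRing R] [CommRing S] [Algebra R S] (ε : S →ₐ[R] R)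

/-! ## §1. Cotangent modules of equal ideals; `ker ε_T` versus `I_T` -/

/-- Cotangent modules of EQUAL ideals are (canonically) isomorphic, linearly over any coefficient ring `R₀ → A`.
[cite: StacksProject, Tag 00RU] -/
def cotangentEquivOfEq {A : Type v} [CommRing A] (R₀ : Type w) [CommRing R₀] [Algebra R₀ A] {I J : Ideal A} (h : I = J) :
    I.Cotangent ≃ₗ[R₀] J.Cotangent := by
  subst h
  exact LinearEquiv.refl R₀ _

/-- `cotangentEquivOfEq` sends the class of `x ∈ I` to the class of `x ∈ J`. [cite: StacksProject, Tag 00RU] -/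
@[simp]
theorem cotangentEquivOfEq_toCotangent {A : Type v} [CommRing A] (R₀ : Type w) [CommRing R₀] [Algebra R₀ A]
    {I J : Ideal A} (h : I = J) (x : I) :
    cotangentEquivOfEq R₀ h (I.toCotangent x) = J.toCotangent ⟨x, h ▸ x.2⟩ := by
  subst h
  rfl

section BaseChange

variable (T : Type w) [CommRing T] [Algebra R T]

/-- **`(ker ε_T)/(ker ε_T)² ≃ I_T/I_T²`**: the augmentation ideal of the base-changed augmentation `ε_T : T ⊗_R S → T` IS the
extended ideal `I_T = I·(T ⊗_R S)` (p602431 `ker_baseChangeAugmentation`), so their cotangent modules agree — the bridge between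
the spelling `augIdeal (baseChangeAugmentation ε T)` and `augIdealBaseChange ε T` of `tensorCotangentEquivOfAugmentation`.
[cite: StacksProject, Tag 00RU] [cite: GortzWedhorn2020, Remark 6.12 (2)–(3)] -/
def cotangentAugIdealBaseChangeEquiv :
    (augIdeal (baseChangeAugmentation ε T)).Cotangent ≃ₗ[T] (augIdealBaseChange ε T).Cotangent :=
  cotangentEquivOfEq T (ker_baseChangeAugmentation ε T)

/-- Hence `T ⊗_R I/I² ≃ₗ[T] (ker ε_T)/(ker ε_T)²` (p602431 composed with the bridge). [cite: GortzWedhorn2020, Remark 6.12 (2)–(3)] -/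
def tensorCotangentEquivAugIdealBaseChangeAugmentation :
    T ⊗[R] (augIdeal ε).Cotangent ≃ₗ[T] (augIdeal (baseChangeAugmentation ε T)).Cotangent :=
  tensorCotangentEquivOfAugmentation ε T ≪≫ₗ (cotangentAugIdealBaseChangeEquiv ε T).symm

end BaseChange

/-! ## §2. `I/I²` of an augmentation ideal is finite over the BASE as soon as it is finite over `S` -/

/-- An ideal kills its conormal module: `i • x = 0` on `I/I²` for `i ∈ I`. [cite: StacksProject, Tag 00RU] -/
theorem smul_cotangent_eq_zero_of_mem {A : Type v} [CommRing A] (I : Ideal A) {i : A} (hi : i ∈ I) (x : I.Cotangent) :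
    i • x = 0 := by
  obtain ⟨z, rfl⟩ := I.toCotangent_surjective x
  rw [← map_smul]
  refine (I.toCotangent_eq_zero _).mpr ?_
  rw [pow_two, Submodule.coe_smul, smul_eq_mul]
  exact Ideal.mul_mem_mul hi z.2

/-- On the conormal module of an AUGMENTATION ideal the `S`-action factors through `ε`: `s • x = ε(s) • x`
(`s − ε(s) ∈ I` kills `I/I²`). [cite: StacksProject, Tag 00RU] -/
theorem smul_cotangent_augIdeal_eq (s : S) (x : (augIdeal ε).Cotangent) : s • x = ε s • x := by
  have h : (s - algebraMap R S (ε s)) • x = 0 :=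
    smul_cotangent_eq_zero_of_mem (augIdeal ε) (sub_algebraMap_mem_augIdeal ε s) x
  rw [sub_smul, sub_eq_zero] at h
  rw [h, algebraMap_smul]

/-- **`I/I²` is a finite `R`-module as soon as it is a finite `S`-module** (for an augmentation ideal `I = ker (ε : S → R)`):
`S`-generators are `R`-generators since `S` acts through `ε`. [cite: GortzWedhorn2020, Remark 6.12 (2)–(3)] -/
theorem finite_cotangent_augIdeal_of_finite [Module.Finite S (augIdeal ε).Cotangent] :
    Module.Finite R (augIdeal ε).Cotangent := by
  obtain ⟨G, hG⟩ := Module.Finite.fg_top (R := S) (M := (augIdeal ε).Cotangent)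
  refine ⟨⟨G, ?_⟩⟩
  rw [eq_top_iff]
  rintro x -
  have hx : x ∈ Submodule.span S (G : Set (augIdeal ε).Cotangent) := hG ▸ Submodule.mem_top
  induction hx using Submodule.span_induction with
  | mem y hy => exact Submodule.subset_span hy
  | zero => exact zero_mem _
  | add y z _ _ hy hz => exact add_mem hy hz
  | smul s y _ hy =>
    rw [smul_cotangent_augIdeal_eq]
    exact Submodule.smul_mem _ _ hy

/-- In particular `I/I²` is finite over `R` when `S` is noetherian (then `I`, hence `I/I²`, is a finite `S`-module).
[cite: GortzWedhorn2020, Remark 6.12 (2)–(3)] -/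
theorem finite_cotangent_augIdeal [IsNoetherianRing S] : Module.Finite R (augIdeal ε).Cotangent := by
  haveI : Module.Finite S (augIdeal ε).Cotangent :=
    Module.Finite.of_surjective (augIdeal ε).toCotangent (augIdeal ε).toCotangent_surjective
  exact finite_cotangent_augIdeal_of_finite ε

/-! ## §3. Over a localised base `R[1/r]`: the conormal module of `ε_{R[1/r]}` is the localised module -/

section Away

variable (r : R)

/-- **`I_{R[1/r]}/I_{R[1/r]}² ≃ₗ[R[1/r]] (I/I²)[1/r]`**: the conormal module of the base-changed augmentation over `R[1/r]` is the
localisation of `I/I²` (p602431 `tensorCotangentEquivOfAugmentation` at `T = R[1/r]`, then Mathlib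
`LocalizedModule.equivTensorProduct`). [cite: GortzWedhorn2020, Remark 6.12 (2)–(3)] [cite: StacksProject, Tag 00RU] -/
def cotangentAugIdealBaseChangeAwayEquiv :
    (augIdealBaseChange ε (Localization.Away r)).Cotangent ≃ₗ[Localization.Away r]
      LocalizedModule.Away r (augIdeal ε).Cotangent :=
  (tensorCotangentEquivOfAugmentation ε (Localization.Away r)).symm ≪≫ₗ
    (LocalizedModule.equivTensorProduct (Submonoid.powers r) (augIdeal ε).Cotangent).symm

/-- Freeness transfers: `(I/I²)[1/r]` free over `R[1/r]` ⇒ `I_{R[1/r]}/I_{R[1/r]}²` free. [cite: EGAIV3, (8.9.4)] -/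
theorem free_cotangent_augIdealBaseChange_away
    [Module.Free (Localization.Away r) (LocalizedModule.Away r (augIdeal ε).Cotangent)] :
    Module.Free (Localization.Away r) (augIdealBaseChange ε (Localization.Away r)).Cotangent :=
  Module.Free.of_equiv (cotangentAugIdealBaseChangeAwayEquiv ε r).symm

/-- Finiteness transfers: `(I/I²)[1/r]` finite over `R[1/r]` ⇒ `I_{R[1/r]}/I_{R[1/r]}²` finite. [cite: EGAIV3, (8.5.5)] -/
theorem finite_cotangent_augIdealBaseChange_away
    [Module.Finite (Localization.Away r) (LocalizedModule.Away r (augIdeal ε).Cotangent)] :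
    Module.Finite (Localization.Away r) (augIdealBaseChange ε (Localization.Away r)).Cotangent :=
  Module.Finite.equiv (cotangentAugIdealBaseChangeAwayEquiv ε r).symm

/-- `(I/I²)[1/r]` is finite over `R[1/r]` when `I/I²` is finite over `R`. [cite: EGAIV3, (8.5.5)] -/
theorem finite_localizedModule_away_cotangent [Module.Finite R (augIdeal ε).Cotangent] :
    Module.Finite (Localization.Away r) (LocalizedModule.Away r (augIdeal ε).Cotangent) :=
  Module.Finite.of_isLocalizedModule (Submonoid.powers r) (LocalizedModule.mkLinearMap (Submonoid.powers r) _)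

end Away

/-! ## §4. Generic freeness of the conormal module over a domain -/

/-- **Generic freeness of the conormal module of a section.**  Let `R` be a noetherian DOMAIN and `(S, ε)` an augmented
`R`-algebra whose conormal module `I/I²` is a finite `S`-module (e.g. `S` noetherian).  Then for some `r ≠ 0` the conormal
module `I_{R[1/r]}/I_{R[1/r]}²` of the base-changed augmentation `ε_{R[1/r]}` is FREE and FINITE over `R[1/r]` — so the
characteristic polynomial of an augmented endomorphism on it is defined over `R[1/r]` and specialises to every point
(p602431 `charpoly_mapCotangent_baseChange` at the base `R[1/r]`).  (`I/I²` is finitely presented over `R`; `I/I² ⊗ Frac R`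
is free over the field `Frac R`; Mathlib `Module.FinitePresentation.exists_free_localizedModule_powers` with `S = R⁰`.)
[cite: EGAIV3, (8.9.4)] [cite: GortzWedhorn2020, Remark 6.12 (2)–(3)] -/
theorem exists_ne_zero_free_cotangent_augIdealBaseChange [IsDomain R] [IsNoetherianRing R]
    [Module.Finite S (augIdeal ε).Cotangent] :
    ∃ r : R, r ≠ 0 ∧ Module.Free (Localization.Away r) (augIdealBaseChange ε (Localization.Away r)).Cotangent ∧
      Module.Finite (Localization.Away r) (augIdealBaseChange ε (Localization.Away r)).Cotangent := by
  haveI : Module.Finite R (augIdeal ε).Cotangent := finite_cotangent_augIdeal_of_finite ε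
  haveI : Module.FinitePresentation R (augIdeal ε).Cotangent := Module.finitePresentation_of_finite R _
  obtain ⟨r, hr, hfree, -⟩ := Module.FinitePresentation.exists_free_localizedModule_powers (nonZeroDivisors R)
    (LocalizedModule.mkLinearMap (nonZeroDivisors R) (augIdeal ε).Cotangent) (FractionRing R)
  haveI := hfree
  haveI := finite_localizedModule_away_cotangent ε r
  exact ⟨r, nonZeroDivisors.ne_zero hr, free_cotangent_augIdealBaseChange_away ε r,
    finite_cotangent_augIdealBaseChange_away ε r⟩

/-- The same with the ideal spelled `ker ε_{R[1/r]}` (through `cotangentAugIdealBaseChangeEquiv`). [cite: EGAIV3, (8.9.4)] -/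
theorem exists_ne_zero_free_cotangent_augIdeal_baseChangeAugmentation [IsDomain R] [IsNoetherianRing R]
    [Module.Finite S (augIdeal ε).Cotangent] :
    ∃ r : R, r ≠ 0 ∧
      Module.Free (Localization.Away r) (augIdeal (baseChangeAugmentation ε (Localization.Away r))).Cotangent ∧
      Module.Finite (Localization.Away r) (augIdeal (baseChangeAugmentation ε (Localization.Away r))).Cotangent := by
  obtain ⟨r, hr, hfree, hfin⟩ := exists_ne_zero_free_cotangent_augIdealBaseChange ε
  haveI := hfree
  haveI := hfin
  exact ⟨r, hr, Module.Free.of_equiv (cotangentAugIdealBaseChangeEquiv ε (Localization.Away r)).symm,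
    Module.Finite.equiv (cotangentAugIdealBaseChangeEquiv ε (Localization.Away r)).symm⟩

end Literature.RingTheory.Smooth

end
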